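import Summits.QuantumAdvantage.QuantumAdvantage.Theorems.CubicForrelationNearExactIsExactTwelveOddWeightFlatType

/-!
# Crux `CubicForrelation.NearExactIsExact` (stmt-QuantumAdvantage-14043) — n = 12, WEIGHT OF A TYPE-O CUBIC, II: type O from the weight,
  a LIGHT DERIVATIVE below `1280`, no periods, and PARITY CELLS

Certificate seat `b2b-cforr-cert` (gen 32).  HONEST FRAMING: kernel-checked finite-slice lemmas (standard axioms) towards "a cubic Boolean function on
12 bits with weight `≡ 8 (mod 16)` has weight `≥ 1280`" (…TwelveOddWeight*), which empties the "`κ₁` type O" branch of the wild (O,O) analysis of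
the open window `(57/64, 29/32)` (PLAN-N12-WINDOW-OO.md §5–6).  NOT summit progress; no value of `θ₁₂`.

* `tow_typeO_of_weight`: a cubic `κ` on 12 bits with `wt κ ≡ 8 (mod 16)` is type O: `W_κ = 16u` with every `u` odd (`u(0) = 256 − wt/8`).
* `tow_light_derivative`: `0 < wt κ < 1280` ⇒ some `a ≠ 0` has `#{x : κ x ≠ κ(x⊕a)} < 1792` (`Σ_a # = 2·wt·(4096 − wt) < 1792·4095`);
  `tow_quadratic_light`: a quadratic on 12 bits with fewer than `1792` ones has `0`, `1024` or `1536` of them (Walsh plateau at the origin).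
* `tow_no_period`: a type-O `κ` has no non-zero period (`W_κ(y) = −W_κ(y)` at a frequency `y` with `a·y = 1`, but `W_κ(y) = 16·odd ≠ 0`).
* Parity cells: `tow_parity_bxor`, `tow_card_paritySet` (`2^k·#{x : zᵢ·x = bᵢ ∀ i<k} = 2^m` for `k` independent forms — character expansion),
  `tow_paritySet_eq_image` (a parity cell is the translate of the annihilator by any of its points), `tow_flatPt_three`.

References: T. Kasami, N. Tokura (1970); R. J. McEliece (1972); C. Carlet (2021) §4.1, §5.1; R. O'Donnell (2014) §1.4, §3.3.  Axioms: the standard three.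
-/

set_option linter.dupNamespace false -- D-0017: single-problem summit ⇒ `QuantumAdvantage.QuantumAdvantage` by design

noncomputable section

namespace Summit.QuantumAdvantage.QuantumAdvantage.Theorems.CubicForrelation.NearExactIsExact

open Finset
open Literature.Computability.QuantumComplexity
open Literature.Computability.QuantumComplexity.BuzetChailloux (bxor zeroVec bxor_bxor_cancel_left bxor_zeroVec zeroVec_bxor bxor_comm
  bxor_self twist_bxor_right twist_zeroVec_right sum_twist_left bxor_eq_zeroVec_iff)
open Literature.Computability.QuantumComplexity.DerivativeWalsh (W twist_bxor_left)

/-! ### Type O from the weight -/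

/-- `W_κ(0) = 4096 − 2·wt(κ)` on 12 bits. [folklore] -/
theorem tow_W_zero (κ : (Fin (6 + 6) → Bool) → Bool) :
    W (fun x => signOf (κ x)) zeroVec = 4096 - 2 * (#(univ.filter fun x : Fin (6 + 6) → Bool => κ x = true) : ℝ) := by
  unfold W
  rw [sum_congr rfl fun x _ => by rw [twist_zeroVec_right, mul_one], tow_sum_signOf_eq, card_univ, Fintype.card_fun,
    Fintype.card_bool, Fintype.card_fin]
  norm_num

/-- **Type O from the weight.**  A cubic `κ` on 12 bits whose number of ones is `≡ 8 (mod 16)` has `W_κ = 16u` with every `u(y)` odd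
(`u(0) = 256 − wt/8` is odd, and the parity of `u` is constant for a cubic on 12 bits). [this work] -/
theorem tow_typeO_of_weight (κ : (Fin (6 + 6) → Bool) → Bool) (hκ : IsDegLeFun 3 κ)
    (hw : #(univ.filter fun x : Fin (6 + 6) → Bool => κ x = true) % 16 = 8) :
    ∃ u : (Fin (6 + 6) → Bool) → ℤ, (∀ y, W (fun x => signOf (κ x)) y = (2 : ℝ) ^ 4 * (u y : ℝ)) ∧ ∀ y, Odd (u y) := by
  obtain ⟨u, hu⟩ := tw_base (n := 6 + 6) κ hκ 4 (by norm_num)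
  refine ⟨u, hu, Summit.QuantumAdvantage.QuantumAdvantage.Theorems.NearExactIsExact.Negative.TypeOTwelve.typeO_of_exists_odd κ u hκ hu
    ⟨zeroVec, ?_⟩⟩
  have h0 := hu zeroVec
  rw [tow_W_zero] at h0
  have h1 : (((4096 : ℤ) - 2 * (#(univ.filter fun x : Fin (6 + 6) → Bool => κ x = true) : ℤ) : ℤ) : ℝ) = ((16 * u zeroVec : ℤ) : ℝ) := by
    push_cast; linarith
  have h2 := Int.cast_injective h1
  rw [Int.odd_iff]
  omega

/-! ### A light derivative -/

/-- **A light derivative below `1280`.**  A Boolean function `κ` on 12 bits with `0 < wt κ < 1280` has a direction `a ≠ 0` with fewer than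
`1792` points where `κ x ≠ κ(x ⊕ a)` (`Σ_a #{κ ≠ κ(·⊕a)} = 2·wt·(4096 − wt) < 1792·4095`). [this work] -/
theorem tow_light_derivative (κ : (Fin (6 + 6) → Bool) → Bool) (hpos : 0 < #(univ.filter fun x : Fin (6 + 6) → Bool => κ x = true))
    (hlt : #(univ.filter fun x : Fin (6 + 6) → Bool => κ x = true) < 1280) :
    ∃ a : Fin (6 + 6) → Bool, a ≠ zeroVec ∧ #(univ.filter fun x => (κ x ^^ κ (bxor x a)) = true) < 1792 := by
  classical
  by_contra hnone
  push Not at hnone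
  have hsum := sw_sum_deriv_card κ
  have hN : (2 : ℕ) ^ (6 + 6) = 4096 := by norm_num
  rw [hN] at hsum
  have h0 : #(univ.filter fun x => (κ x ^^ κ (bxor x (zeroVec : Fin (6 + 6) → Bool))) = true) = 0 := by
    rw [card_eq_zero, filter_eq_empty_iff]; intro x _; rw [bxor_zeroVec, Bool.xor_self]; exact Bool.false_ne_true
  have hge : ∀ a ∈ (univ : Finset (Fin (6 + 6) → Bool)).erase zeroVec, 1792 ≤ #(univ.filter fun x => (κ x ^^ κ (bxor x a)) = true) :=
    fun a ha => hnone a (ne_of_mem_erase ha)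
  have hsplit := sum_erase_add (univ : Finset (Fin (6 + 6) → Bool))
    (fun a => (#(univ.filter fun x => (κ x ^^ κ (bxor x a)) = true) : ℕ)) (mem_univ zeroVec)
  rw [h0, add_zero, hsum] at hsplit
  have hcard : #((univ : Finset (Fin (6 + 6) → Bool)).erase zeroVec) = 4095 := by
    rw [card_erase_of_mem (mem_univ _), card_univ, Fintype.card_fun, Fintype.card_bool, Fintype.card_fin]; norm_num
  have hle : 4095 * 1792 ≤ ∑ a ∈ (univ : Finset (Fin (6 + 6) → Bool)).erase zeroVec,
      (#(univ.filter fun x => (κ x ^^ κ (bxor x a)) = true) : ℕ) := by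
    rw [← hcard, ← smul_eq_mul, ← sum_const]; exact sum_le_sum hge
  rw [hsplit] at hle
  set w := #(univ.filter fun x : Fin (6 + 6) → Bool => κ x = true)
  obtain ⟨v, hv⟩ : ∃ v, 4096 - w = v := ⟨_, rfl⟩
  rw [hv] at hle
  have hv' : w + v = 4096 := by omega
  have hleZ : (4095 : ℤ) * 1792 ≤ 2 * (w : ℤ) * (v : ℤ) := by exact_mod_cast hle
  have hw1 : (w : ℤ) ≤ 1279 := by exact_mod_cast (show w ≤ 1279 by omega)
  have hv1 : (2817 : ℤ) ≤ v := by exact_mod_cast (show 2817 ≤ v by omega)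
  nlinarith [mul_nonneg (sub_nonneg.2 hw1) (sub_nonneg.2 hv1)]

/-- **Light quadratics.**  A Boolean function of degree `≤ 2` on 12 bits with fewer than `1792` ones has `0`, `1024` or `1536` of them
(`W(0) = 4096 − 2# > 512` is a power of two by the Walsh plateau `stub_quadWalshPlateau`). [cite: MacWilliamsSloane1977, Ch. 15 §2] -/
theorem tow_quadratic_light (q : (Fin (6 + 6) → Bool) → Bool) (hq : IsDegLeFun 2 q)
    (hlt : #(univ.filter fun x : Fin (6 + 6) → Bool => q x = true) < 1792) :
    #(univ.filter fun x : Fin (6 + 6) → Bool => q x = true) = 0 ∨ #(univ.filter fun x : Fin (6 + 6) → Bool => q x = true) = 1024 ∨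
      #(univ.filter fun x : Fin (6 + 6) → Bool => q x = true) = 1536 := by
  obtain ⟨s, hs⟩ := stub_quadWalshPlateau (6 + 6) q hq
  have h0 := tow_W_zero q
  set c := #(univ.filter fun x : Fin (6 + 6) → Bool => q x = true) with hcdef
  have hcR : (c : ℝ) < 1792 := by exact_mod_cast hlt
  rcases hs zeroVec with hz | hsq
  · rw [hz] at h0
    linarith
  · rw [h0] at hsq
    have h1 : ((4096 : ℝ) - 2 * c) ^ 2 = ((2 : ℝ) ^ s) ^ 2 := by
      rw [hsq, ← pow_mul, mul_comm, pow_mul]; norm_num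
    have h2 : (4096 : ℝ) - 2 * c = (2 : ℝ) ^ s := (pow_left_inj₀ (by linarith) (by positivity) two_ne_zero).1 h1
    have h3 : ((4096 - 2 * (c : ℤ) : ℤ) : ℝ) = ((2 ^ s : ℤ) : ℝ) := by push_cast; linarith
    have h4 := Int.cast_injective h3
    have hsle : s ≤ 12 := by
      by_contra hcon
      have : (2 : ℤ) ^ 13 ≤ 2 ^ s := pow_le_pow_right₀ (by norm_num) (by omega)
      omega
    interval_cases s <;> omega

/-! ### No periods for type O -/

/-- **No period.**  A type-O cubic (`W_κ = 16u`, all `u` odd) on 12 bits has no period `a ≠ 0`: if `κ(· ⊕ a) = κ` then at a frequency `y` with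
`a·y = 1` the Walsh value satisfies `W_κ(y) = −W_κ(y)`, i.e. `u(y) = 0`, which is even. [this work] -/
theorem tow_no_period (κ : (Fin (6 + 6) → Bool) → Bool) (u : (Fin (6 + 6) → Bool) → ℤ)
    (hu : ∀ y, W (fun x => signOf (κ x)) y = (2 : ℝ) ^ 4 * (u y : ℝ)) (hodd : ∀ y, Odd (u y))
    (a : Fin (6 + 6) → Bool) (ha : a ≠ zeroVec) :
    #(univ.filter fun x => (κ x ^^ κ (bxor x a)) = true) ≠ 0 := by
  classical
  intro h0
  have hper : ∀ x, κ (bxor x a) = κ x := fun x => (mem_filter.1 ((sw_mem_periods_iff κ a).2 h0)).2 x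
  obtain ⟨y, hy⟩ := es_exists_twist_neg ha
  have h1 := tow_W_shift κ a y
  rw [show (fun x => signOf (κ (bxor x a))) = (fun x => signOf (κ x)) from funext fun x => by rw [hper x], hy, hu y] at h1
  have h2 : (u y : ℝ) = 0 := by linarith
  have h3 : u y = 0 := by exact_mod_cast h2
  have h4 := hodd y
  rw [h3] at h4
  exact (by decide : ¬ Odd (0 : ℤ)) h4

/-! ### Parity cells -/

/-- Parities are additive: `⟨x ⊕ y, z⟩ = ⟨x,z⟩ ⊕ ⟨y,z⟩`. [folklore] -/
theorem tow_parity_bxor {m : ℕ} (x y z : Fin m → Bool) :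
    decide (Odd #(univ.filter fun j => bxor x y j && z j)) =
      (decide (Odd #(univ.filter fun j => x j && z j)) ^^ decide (Odd #(univ.filter fun j => y j && z j))) := by
  have h := twist_bxor_left x y z
  rw [vg_twist_eq_signOf, vg_twist_eq_signOf, vg_twist_eq_signOf, ← signOf_xor] at h
  revert h
  cases decide (Odd #(univ.filter fun j => bxor x y j && z j)) <;> cases decide (Odd #(univ.filter fun j => x j && z j)) <;>
    cases decide (Odd #(univ.filter fun j => y j && z j)) <;> norm_num [signOf]

/-- `twist x z = 1 ↔ ⟨x,z⟩` is even. [folklore] -/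
theorem tow_twist_eq_one_iff_parity {m : ℕ} (x z : Fin m → Bool) :
    twist x z = 1 ↔ decide (Odd #(univ.filter fun j => x j && z j)) = false := by
  rw [vg_twist_eq_signOf]
  cases decide (Odd #(univ.filter fun j => x j && z j)) <;> norm_num [signOf]

/-- The flat point on three directions, as an explicit xor. [folklore] -/
theorem tow_flatPt_three {m : ℕ} (b : Fin m → Bool) (a : Fin 3 → Fin m → Bool) (ε : Fin 3 → Bool) :
    (fun j => b j ^^ decide (Odd #(univ.filter fun i => ε i && a i j))) =
      fun j => b j ^^ ((ε 0 && a 0 j) ^^ (ε 1 && a 1 j) ^^ (ε 2 && a 2 j)) := by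
  funext j
  rw [card_filter, Fin.sum_univ_three]
  congr 1
  cases ε 0 <;> cases ε 1 <;> cases ε 2 <;> cases a 0 j <;> cases a 1 j <;> cases a 2 j <;> decide

/-- **Size of a parity cell.**  For `k` forms `z₀,…,z_{k−1}` on `m` bits such that no non-empty xor of them vanishes, and any signs `b`:
`2^k · #{x : ⟨x,zᵢ⟩ = bᵢ ∀ i} = 2^m` (expand `Π (1 + (−1)^{bᵢ}(−1)^{x·zᵢ})` into characters). [cite: ODonnell2014, §3.3] -/
theorem tow_card_paritySet {m k : ℕ} (z : Fin k → Fin m → Bool) (b : Fin k → Bool)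
    (hind : ∀ ε : Fin k → Bool, ε ≠ (fun _ => false) →
      (fun j => (zeroVec : Fin m → Bool) j ^^ decide (Odd #(univ.filter fun i => ε i && z i j))) ≠ zeroVec) :
    2 ^ k * #(univ.filter fun x : Fin m → Bool => ∀ i, decide (Odd #(univ.filter fun j => x j && z i j)) = b i) = 2 ^ m := by
  classical
  set ℓ : Fin k → (Fin m → Bool) → Bool := fun i x => decide (Odd #(univ.filter fun j => x j && z i j)) with hℓdef
  -- the indicator of the cell as a product of `(1 + (−1)^{bᵢ}(−1)^{x·zᵢ})/2`
  have hind1 : ∀ x i, (if ℓ i x = b i then (1 : ℝ) else 0) * 2 = 1 + signOf (b i) * twist x (z i) := by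
    intro x i
    rw [vg_twist_eq_signOf]
    change (if ℓ i x = b i then (1 : ℝ) else 0) * 2 = 1 + signOf (b i) * signOf (ℓ i x)
    cases ℓ i x <;> cases b i <;> norm_num [signOf]
  have hbool : ∀ x, (if (∀ i, ℓ i x = b i) then (1 : ℝ) else 0) = ∏ i, (if ℓ i x = b i then (1 : ℝ) else 0) := by
    intro x
    by_cases h : ∀ i, ℓ i x = b i
    · rw [if_pos h]; exact (prod_eq_one fun i _ => by rw [if_pos (h i)]).symm
    · rw [if_neg h]
      push Not at h
      obtain ⟨i, hi⟩ := h
      exact (prod_eq_zero (mem_univ i) (by rw [if_neg hi])).symm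
  have hprod : ∀ x, (if (∀ i, ℓ i x = b i) then (1 : ℝ) else 0) * 2 ^ k = ∏ i, (1 + signOf (b i) * twist x (z i)) := by
    intro x
    rw [hbool, show (2 : ℝ) ^ k = ∏ _i : Fin k, (2 : ℝ) by rw [prod_const, card_univ, Fintype.card_fin], ← prod_mul_distrib]
    exact prod_congr rfl fun i _ => hind1 x i
  -- expand the product into characters of the flat points
  have hexp : ∀ x, ∏ i, (1 + signOf (b i) * twist x (z i)) =
      ∑ ε : Fin k → Bool, (∏ i, (if ε i then signOf (b i) else 1)) *
        twist (fun j => (zeroVec : Fin m → Bool) j ^^ decide (Odd #(univ.filter fun i => ε i && z i j))) x := by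
    intro x
    have e1 : ∏ i, (1 + signOf (b i) * twist x (z i)) = ∏ i, ∑ e : Bool, (if e then signOf (b i) * twist x (z i) else (1 : ℝ)) :=
      prod_congr rfl fun i _ => by rw [Fintype.sum_bool, if_pos rfl, if_neg Bool.false_ne_true, add_comm]
    rw [e1, Fintype.prod_sum]
    refine sum_congr rfl fun ε _ => ?_
    rw [ed_twist_flatPt, Literature.Computability.QuantumComplexity.twist_comm zeroVec x, twist_zeroVec_right, one_mul,
      ← prod_mul_distrib]
    exact prod_congr rfl fun i _ => by
      rw [Literature.Computability.QuantumComplexity.twist_comm (z i) x]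
      cases ε i <;> simp
  -- sum over `x`: only `ε = 0` survives
  have hsumx : ∑ x : Fin m → Bool, ∏ i, (1 + signOf (b i) * twist x (z i)) = 2 ^ m := by
    rw [sum_congr rfl fun x _ => hexp x, sum_comm, Fintype.sum_eq_single (fun _ : Fin k => false)]
    · have e0 : (fun j => (zeroVec : Fin m → Bool) j ^^ decide (Odd #(univ.filter fun i => (fun _ : Fin k => false) i && z i j))) =
          zeroVec := by
        funext j; simp [zeroVec]
      rw [← mul_sum, e0, sum_congr rfl fun x _ => Literature.Computability.QuantumComplexity.twist_comm zeroVec x, sum_twist_left,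
        if_pos rfl, prod_congr rfl fun i _ => if_neg Bool.false_ne_true, prod_const_one, one_mul]
    · intro ε hε
      rw [← mul_sum, sum_congr rfl fun x _ => Literature.Computability.QuantumComplexity.twist_comm _ x, sum_twist_left,
        if_neg (hind ε hε), mul_zero]
  -- conclude
  have key : ((2 ^ k * #(univ.filter fun x : Fin m → Bool => ∀ i, ℓ i x = b i) : ℕ) : ℝ) = ((2 ^ m : ℕ) : ℝ) := by
    push_cast
    rw [← hsumx, ← sum_congr rfl fun x _ => hprod x, ← sum_mul, sum_boole, mul_comm]
  exact_mod_cast key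

/-- **A parity cell is a translate of the annihilator.**  If `p` has parities `⟨p,zᵢ⟩ = bᵢ` then
`{x : ⟨x,zᵢ⟩ = bᵢ ∀ i} = {t : ⟨t,zᵢ⟩ even ∀ i} ⊕ p`. [folklore] -/
theorem tow_paritySet_eq_image {m k : ℕ} (z : Fin k → Fin m → Bool) (b : Fin k → Bool) (p : Fin m → Bool)
    (hp : ∀ i, decide (Odd #(univ.filter fun j => p j && z i j)) = b i) :
    (univ.filter fun x : Fin m → Bool => ∀ i, decide (Odd #(univ.filter fun j => x j && z i j)) = b i) =
      (univ.filter fun t : Fin m → Bool => ∀ i, twist (z i) t = 1).image (bxor p) := by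
  classical
  ext x
  simp only [mem_filter, mem_univ, true_and, mem_image]
  constructor
  · intro hx
    refine ⟨bxor p x, fun i => ?_, bxor_bxor_cancel_left p x⟩
    rw [Literature.Computability.QuantumComplexity.twist_comm, tow_twist_eq_one_iff_parity, tow_parity_bxor, hp i, hx i, Bool.xor_self]
  · rintro ⟨t, ht, rfl⟩ i
    rw [tow_parity_bxor, hp i]
    have := ht i
    rw [Literature.Computability.QuantumComplexity.twist_comm, tow_twist_eq_one_iff_parity] at this
    rw [this, Bool.xor_false]

end Summit.QuantumAdvantage.QuantumAdvantage.Theorems.CubicForrelation.NearExactIsExact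

end
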